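import Literature.AlgebraicGeometry.Frobenioids.PerfectionUnitsIsoFrTriv
import Literature.AlgebraicGeometry.Frobenioids.PerfectionEndCoAngularTransfer
import Literature.AlgebraicGeometry.Frobenioids.IsotropicFrobenioid
import Literature.AlgebraicGeometry.Frobenioids.PerfectionDivisorial
import HarnessLib

/-!
# Frobenioids I, Proposition 5.5 (i): `O^▷(A)^pf ⥲ O^▷(A^pf)` for an isotropic object `A`

Mochizuki, *The geometry of Frobenioids I: the general theory*, Kyushu J. Math. **62** (2008)
293–400, Proposition 5.5 (i) p. 104: "Suppose that `C` is of Frobenius-isotropic and Frobenius-normalized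
type. Then: (i) If `A ∈ Ob(C^istr)` maps to an object `A^pf ∈ Ob(C^pf)`, then the natural functor `C → C^pf`
determines a natural isomorphism `O^▷(A)^pf ⥲ O^▷(A^pf)`"; proof p. 104 l. 46 – p. 105 l. 1: "… the case
of arbitrary `A` then follows by considering 'pairs of pre-steps' as in Theorem 5.1, (i) [cf. also
Definition 1.3, (iii), (c)]" [cite: MochizukiFrdI2008, Prop. 5.5 (i) p.104].

Sub-node FrdI:Prop5.5(i)/P55-L02 (`PerfectionUnitsIsoGeneral`) of the cell's SUBDAG-FrdI-Thm51iv-Prop55, for THE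
perfection `PreFrobenioidData.perfection hF`; with P55-L01 (`PerfectionUnitsIsoFrTriv.lean`) this closes
Prop. 5.5 (i).  The printed argument, made explicit: for `A` isotropic, the Frobenioid `C^istr` (Prop. 1.9 (v),
`isFrobenioid_istr`) supplies by Def. 1.3 (i)(a)(b) an isotropic Frobenius-trivial `A₀` over `Base(A)` and an
`A`-pair of pre-steps `φ : X → A`, `ψ : X → A₀` with `X` isotropic — co-angular since every arrow out of an
isotropic object is (Def. 1.3 (vii)(b), Prop. 1.4 (i); `isCoAngular_of_isIsotropic`).  Def. 1.3 (iii)(c) along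
`φ`, `ψ` identifies `O^▷(A) ≅ O^▷(X) ≅ O^▷(A₀)`, hence their perfections (`Frobenioids.Perfection.congr`, `PerfectionDivisorial.lean`),
and, applied at every level of `C^pf` (`endTransfer`, `PerfectionEndCoAngularTransfer.lean`), identifies
`O^▷((A, 1)) ≅ O^▷((X, 1)) ≅ O^▷((A₀, 1))`; the Frobenius-trivial case `O^▷(A₀)^pf ⥲ O^▷((A₀, 1))`
(`endPerfectionEquiv`) then transfers to `A` (`prop55i_of_isIsotropic`), compatibly with `C → C^pf`
(`endTransfer_toPfEnd`).  HYPOTHESES USED: `C` of Frobenius-normalized type and `A` isotropic; print's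
"Frobenius-isotropic type" is not needed for (i) (it is for (ii)–(iv)).
-/

namespace Literature.AlgebraicGeometry.Frobenioids

open CategoryTheory Opposite

universe w v v' u u'


namespace PreFrobenioid

variable {D : Type u} [Category.{v} D] {Φ : Dᵒᵖ ⥤ CommMonCat.{w}}
  {C : Type u'} [Category.{v'} C] {F : C ⥤ ElemFrobenioid Φ}

/-! ### Arrows out of isotropic objects are co-angular -/

/-- In a Frobenioid every arrow out of an isotropic object is co-angular: all objects receiving an arrow from an
isotropic object are isotropic (Def. 1.3 (vii)(b)), so Prop. 1.4 (i) applies.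
[cite: MochizukiFrdI2008, Prop. 1.4 (i) p.26] -/
theorem isCoAngular_of_isIsotropic (hF : IsFrobenioid F) {X Y : C} (hX : IsIsotropic F X) (f : X ⟶ Y) : IsCoAngular F f :=
  isCoAngular_of_isIsotropic_codomains F f fun _ g => hF.vii_b g hX

/-! ### The `A`-pair of co-angular pre-steps through a Frobenius-trivial object -/

/-- For an isotropic object `A` there are an isotropic Frobenius-trivial object `A₀` and an `A`-pair of
co-angular pre-steps `φ : X → A`, `ψ : X → A₀` with `X` isotropic (Def. 1.3 (i)(a)(b) in the Frobenioid
`C^istr` of Prop. 1.9 (v); "pairs of pre-steps as in Theorem 5.1, (i)").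
[cite: MochizukiFrdI2008, Prop. 5.5 (i) p.104] -/
theorem exists_coAngularPreStep_pair (hF : IsFrobenioid F) {A : C} (hA : IsIsotropic F A) :
    ∃ (X A₀ : C) (φ : X ⟶ A) (ψ : X ⟶ A₀), IsIsotropic F X ∧ IsIsotropic F A₀ ∧ IsFrobeniusTrivial F A₀ ∧
      IsCoAngularPreStep F φ ∧ IsCoAngularPreStep F ψ := by
  have hI := isFrobenioid_istr hF
  obtain ⟨A₀, hA₀, ⟨e⟩⟩ := hI.i_a (baseObj F A)
  obtain ⟨X, φ, ψ, hφ, hψ, -⟩ := hI.i_b (Istr.mk A hA) A₀ e.symm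
  exact ⟨X.obj, A₀.obj, φ.hom, ψ.hom, X.property, A₀.property, (isFrobeniusTrivial_istr_iff hF A₀).mp hA₀,
    ⟨isCoAngular_of_isIsotropic hF X.property _, (isPreStep_istr_iff φ).mp hφ⟩,
    ⟨isCoAngular_of_isIsotropic hF X.property _, (isPreStep_istr_iff ψ).mp hψ⟩⟩

namespace Perfection

/-! ### Proposition 5.5 (i) for an isotropic object -/

/-- The Frobenius-trivial isomorphism `O^▷(A₀)^pf ⥲ O^▷((A₀, 1))` as an equation of elements of `O^▷((A₀, 1))`:
it sends the class of `α` to `toPfEnd α`. [cite: MochizukiFrdI2008, Prop. 5.5 (i) p.104] -/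
theorem endPerfectionEquiv_of_eq_toPfEnd (hF : IsFrobenioid F) {A : C} (ζ : ℕ+ →* End A)
    (hζ : ∀ n : ℕ+, degFr F (ζ n) = n ∧ IsBaseIdentity F (ζ n) ∧ IsFrobeniusType F (ζ n))
    (hn : IsFrobeniusNormalized F A) (α : endSubmonoid F A) :
    endPerfectionEquiv hF ζ hζ hn (@Frobenioids.Perfection.of _ (endCommMonoid F hF A) α) = toPfEnd hF α :=
  Subtype.ext (endPerfectionEquiv_of hF ζ hζ hn α)

/-- **Proposition 5.5 (i)** (print p. 104), for THE perfection `PreFrobenioidData.perfection hF`: for `C` of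
Frobenius-normalized type and an isotropic object `A`, "the natural functor `C → C^pf` determines a natural
isomorphism `O^▷(A)^pf ⥲ O^▷(A^pf)`" — a multiplicative bijection from the perfection of `O^▷(A)` (Remark
1.3.1 commutative-monoid structure `endCommMonoid`) onto `O^▷((A, 1))` sending the class of `α ∈ O^▷(A)` to the
image of `α` under `C → C^pf`. [cite: MochizukiFrdI2008, Prop. 5.5 (i) p.104] -/
theorem prop55i_of_isIsotropic (hF : IsFrobenioid F) (hnorm : IsOfType (IsFrobeniusNormalized F)) {A : C}
    (hA : IsIsotropic F A) :
    ∃ e : @Frobenioids.Perfection (endSubmonoid F A) (endCommMonoid F hF A) ≃*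
        (ops hF).endSubmonoid ((toPf hF).obj A),
      ∀ α : endSubmonoid F A,
        (e (@Frobenioids.Perfection.of _ (endCommMonoid F hF A) α)).1 = (toPf hF).map (End.asHom α.1) := by
  obtain ⟨X, A₀, φ, ψ, -, -, ⟨ζ, hζ⟩, hφ, hψ⟩ := exists_coAngularPreStep_pair hF hA
  obtain ⟨eφ, heφ⟩ := hF.iii_c φ hφ
  obtain ⟨eψ, heψ⟩ := hF.iii_c ψ hψ
  letI := endCommMonoid F hF A
  letI := endCommMonoid F hF X
  letI := endCommMonoid F hF A₀
  -- `O^▷(A)^pf ≅ O^▷(A₀)^pf` (Def. 1.3 (iii)(c) along `φ`, `ψ`), the Frobenius-trivial case for `A₀`, and the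
  -- transfers `O^▷((A₀, 1)) ≅ O^▷((X, 1)) ≅ O^▷((A, 1))` in `C^pf`
  refine ⟨(Frobenioids.Perfection.congr (eφ.symm.trans eψ)).trans
      ((endPerfectionEquiv hF ζ hζ (hnorm A₀)).trans
        ((endTransfer hF ψ hψ).symm.trans (endTransfer hF φ hφ))), fun α => ?_⟩
  have h₁ : endTransfer hF ψ hψ (toPfEnd hF (eφ.symm α)) = toPfEnd hF (eψ (eφ.symm α)) :=
    endTransfer_toPfEnd hF ψ hψ eψ (fun β => heψ β) (eφ.symm α)
  have h₂ : endTransfer hF φ hφ (toPfEnd hF (eφ.symm α)) = toPfEnd hF α := by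
    rw [endTransfer_toPfEnd hF φ hφ eφ (fun β => heφ β) (eφ.symm α), MulEquiv.apply_symm_apply]
  rw [MulEquiv.trans_apply, MulEquiv.trans_apply, MulEquiv.trans_apply, Frobenioids.Perfection.congr_of,
    MulEquiv.trans_apply, endPerfectionEquiv_of_eq_toPfEnd, ← h₁, MulEquiv.symm_apply_apply, h₂]
  rfl

/-- **The slot `FrdI.Prop55Sub.Prop55i` of `Prop55Sub.lean`, DISCHARGED for THE perfection** (node
FrdI:Prop5.5(i); print's hypothesis "of Frobenius-isotropic type" is not used).
[cite: MochizukiFrdI2008, Prop. 5.5 (i) p.104] -/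
theorem _root_.Literature.AlgebraicGeometry.Frobenioids.FrdI.Prop55Sub.prop55i_holds (hF : IsFrobenioid F)
    (A : C) : FrdI.Prop55Sub.Prop55i F hF A :=
  fun _ hnorm hA => prop55i_of_isIsotropic hF hnorm hA

end Perfection

end PreFrobenioid

end Literature.AlgebraicGeometry.Frobenioids
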